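import Mathlib
import HarnessLib.Audit
import Summits.PneNP.PneNP.Theorems.PstarNorDataCounts
import Summits.PneNP.PneNP.Theorems.PstarNorDataTriangle

/-!
# The NOR-core accounting lemma, generic form: `#J₀ ≤ 5` (ROUND-24, GAPTWO-PLAN v1 S4c)

FRONTIER range-avoidance ladder, rung F-N3, ROUND 24 (cell `pnp-ideate`; restricted-model proof complexity — nothing here bears
on `P` versus `NP`).

`card_le_five` — an XOR-closed set `J₀` of outputs carrying generic NOR data `CoreData I J₀ C σ τ g₀` (`PstarNorDataTools`) on a pure
instance with simple overlaps and `(r, 3/2)`-boundary expansion (`#J₀ < r`) has at most `5` outputs (planner memo `CORE-BOUND-NOTES.md`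
§5); both typed forms of GAPTWO-PLAN S4c (`PstarNorCore.NorCoreBound`, `PstarLitNorCore.LitNorCoreBound`) are instances.  The proof is
the memo's accounting, reorganised WITHOUT a component decomposition of the centre graph.  Write `c = #C`, `s = #(J₀ ∖ C)` (chords),
`η`, `ι` for the numbers of XOR variables of centre degree `1`, `2` (no variable has centre degree `≥ 3`, `PstarNorCoreTools.cdeg_le_two`):

1. every chord closes a triangle with an apex of centre degree two, and distinct chords have distinct apexes
   (`PstarNorDataTriangle.apex`, `apex_inj`), so `s ≤ ι` (`card_chd_le_iota`);
2. handshake `2c = η + 2ι`; global count (family `J₀ ∪ {g₀}`) `c ≤ s + 1` once both classes are non-empty — otherwise there is no chord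
   and the same count gives `#J₀ = c ≤ 5` outright; hence `η ≤ 2`;
3. centre count `3c ≤ 2(η + c + [σ ∈ bdry cen] + [τ ∈ bdry cen])` with `ι ≤ 2·#cls σ`, `ι ≤ 2·#cls τ`, `#cls σ + #cls τ = c`, and a class
   with two members is not private: this leaves `η = 0 ⇒ c ≤ 2` and `η = 2 ⇒ c ≤ 4`, with `#J₀ = 2c - 1 ≤ 5` unless `c = 4`;
4. `c = 4`, `η = 2`, `s = 3` is impossible (`four_false`): each chord's ends have centre degree two (family `cen ∪ {e}`), so a chord's
   apex and ends are exactly the three vertices of centre degree two; a second chord then puts a centre edge on the two ends of the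
   first, and the three centre edges of that triangle would have to lie pairwise in different classes — there are only two.
-/

set_option linter.dupNamespace false

open Finset Literature.Computability.Complexity
open Summit.PneNP.PneNP.Theorems.PstarSALevel (varSet bdry BoundaryExpanding SimpleOverlap)
open Summit.PneNP.PneNP.Theorems.PstarGapLinearised (andPair andPair_subset_varSet)
open Summit.PneNP.PneNP.Theorems.PstarCentreFree (vars_mem_varSet)
open Summit.PneNP.PneNP.Theorems.PstarGapOneKills (mem_andPair_of_slot)
open Summit.PneNP.PneNP.Theorems.PstarCoreBound (XorClosed)
open Summit.PneNP.PneNP.Theorems.PstarNorCoreTools (not_mem_bdry_of_two card_varSet_inter_bdry_le card_bdry_le_sum eq_of_mem_bdry xorPair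
  mem_xorPair_iff xorPair_subset_varSet card_xorPair_le vars_zero_ne_one card_xorPair ne_of_xorPair_eq oth)
open Summit.PneNP.PneNP.Theorems.PstarNorDataTools
open Summit.PneNP.PneNP.Theorems.PstarNorDataCounts (global_count cen_count)
open Summit.PneNP.PneNP.Theorems.PstarNorDataTriangle (sigma_tau_of_shared apex apex_inj)

namespace Summit.PneNP.PneNP.Theorems.PstarNorDataProof

variable {n m : ℕ}

section Nor

variable {I : LocalMap 4 n m} {J₀ C : Finset (Fin m)}
variable (hI : I.IsPure xorAndPred) (hS : SimpleOverlap I) {σ τ : Fin n} {g₀ : Fin m} (hN : CoreData I J₀ C σ τ g₀)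
variable {r : ℕ} (hB : BoundaryExpanding r I) (hk : J₀.card < r)

include hS hN in
/-- The two classes partition the centre edges: `#cls σ + #cls τ = #cen`. -/
theorem card_cls_add : (cls I C σ).card + (cls I C τ).card = (C).card := by
  classical
  rw [← card_union_of_disjoint (disjoint_left.2 fun f h1 h2 => not_mem_cls_both hS hN h1 h2)]
  congr 1
  ext f
  rw [mem_union]
  exact ⟨fun h => h.elim (fun h => cls_subset I C σ h) fun h => cls_subset I C τ h, fun h => mem_cls_or hN h⟩

include hI hS hN hB hk in
/-- **`s ≤ ι`**: chords inject into the vertices of centre degree two by their apex. -/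
theorem card_chd_le_iota : ((J₀ \ C)).card ≤ (univ.filter fun v => cdeg I C v = 2).card := by
  classical
  have hap : ∀ e ∈ (J₀ \ C), ∃ v : Fin n, cdeg I C v = 2 ∧ ∃ f₁ ∈ C, ∃ f₂ ∈ C, f₁ ≠ f₂ ∧
      xorPair I f₁ = {I.vars e 0, v} ∧ xorPair I f₂ = {v, I.vars e 1} ∧ v ≠ I.vars e 0 ∧ v ≠ I.vars e 1 := by
    intro e he
    obtain ⟨v, f₁, hf₁, f₂, hf₂, hne, hx₁, hx₂, hva, hvb, hcd, -⟩ := apex hI hS hN hB hk he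
    exact ⟨v, hcd, f₁, hf₁, f₂, hf₂, hne, hx₁, hx₂, hva, hvb⟩
  haveI : Nonempty (Fin n) := ⟨σ⟩
  choose! ap hap using hap
  refine card_le_card_of_injOn ap (fun e he => mem_filter.2 ⟨mem_univ _, (hap e he).1⟩) fun e he e' he' h => ?_
  obtain ⟨-, f₁, hf₁, f₂, hf₂, hne, hx₁, hx₂, hva, hvb⟩ := hap e he
  obtain ⟨-, f₁', hf₁', f₂', hf₂', hne', hx₁', hx₂', hva', hvb'⟩ := hap e' he'
  rw [h] at hx₁ hx₂ hva hvb
  exact apex_inj hI hS hN hf₁ hf₂ hf₁' hf₂' hne hne' hx₁ hx₂ hx₁' hx₂' hva hvb hva' hvb'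

include hI hS hN hB hk in
/-- **Ends of a chord have centre degree two** when `#cen = 4`, `η = 2` and both classes have two members (family `cen ∪ {e}`:
an end of centre degree one would be a private XOR variable too few). -/
theorem cdeg_end_eq_two (hc : (C).card = 4) (hη : (univ.filter fun v => cdeg I C v = 1).card = 2)
    (hσ2 : (cls I C σ).card = 2) (hτ2 : (cls I C τ).card = 2) {e : Fin m} (he : e ∈ (J₀ \ C)) {v : Fin n} {f₁ f₂ : Fin m}
    (hf₁ : f₁ ∈ C) (hf₂ : f₂ ∈ C) (hx₁ : xorPair I f₁ = {I.vars e 0, v}) (hx₂ : xorPair I f₂ = {v, I.vars e 1}) :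
    cdeg I C (I.vars e 0) = 2 ∧ cdeg I C (I.vars e 1) = 2 := by
  classical
  obtain ⟨heJ, -⟩ := mem_sdiff.1 he
  have hsum := card_cen_add_card_chd C hN.1
  have hs1 : 1 ≤ ((J₀ \ C)).card := card_pos.2 ⟨e, he⟩
  set a := I.vars e 0 with ha
  set b := I.vars e 1 with hb
  set C := C with hC
  set X := insert e C with hX
  have heC : e ∉ C := fun h => ne_of_mem_of_mem_sdiff h he rfl
  have hXcard : X.card = 5 := by rw [hX, card_insert_of_notMem heC, hc]
  have hXr : X.card ≤ r := by omega
  have hexp := hB X hXr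
  have heX : e ∈ X := mem_insert_self _ _
  have hCX : C ⊆ X := subset_insert _ _
  have ha₁ : a ∈ xorPair I f₁ := by rw [hx₁]; exact mem_insert_self _ _
  have hb₂ : b ∈ xorPair I f₂ := by rw [hx₂]; exact mem_insert_of_mem (mem_singleton_self _)
  have hσb : σ ∉ bdry I X := sigma_not_mem_bdry ((cls_subset I C σ).trans hCX) (by omega)
  have hτb : τ ∉ bdry I X := sigma_not_mem_bdry ((cls_subset I C τ).trans hCX) (by omega)
  -- cover of the boundary
  set E₁ := (univ.filter fun v => cdeg I C v = 1) with hE₁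
  have hcov : bdry I X ⊆ (E₁ \ {a, b}) ∪ C.image (oth I σ τ) ∪ andPair I e := by
    intro w hw
    have hw' := hw
    unfold PstarSALevel.bdry at hw'
    rw [mem_filter, card_eq_one] at hw'
    obtain ⟨j, hj⟩ := hw'.2
    have hjm : j ∈ X.filter fun j => w ∈ varSet I j := by rw [hj]; exact mem_singleton_self j
    rw [mem_filter] at hjm
    obtain ⟨hjX, hwj⟩ := hjm
    unfold PstarSALevel.varSet at hwj
    obtain ⟨t, -, htw⟩ := mem_image.1 hwj
    rw [mem_union, mem_union]
    rcases mem_insert.1 hjX with rfl | hjC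
    · -- read by the chord: an AND slot (its XOR slots lie on `f₁`, `f₂`)
      by_cases ht : t.val < 2
      · exfalso
        have : w = a ∨ w = b := by
          fin_cases t
          · exact Or.inl htw.symm
          · exact Or.inr htw.symm
          · exact absurd ht (by decide)
          · exact absurd ht (by decide)
        rcases this with rfl | rfl
        · exact not_mem_bdry_of_two I heX (hCX hf₁) (ne_of_mem_of_mem_sdiff hf₁ he).symm (vars_mem_varSet I j 0)
            (xorPair_subset_varSet I f₁ ha₁) hw
        · exact not_mem_bdry_of_two I heX (hCX hf₂) (ne_of_mem_of_mem_sdiff hf₂ he).symm (vars_mem_varSet I j 1)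
            (xorPair_subset_varSet I f₂ hb₂) hw
      · right
        push Not at ht
        exact htw ▸ mem_andPair_of_slot I j t ht
    · by_cases ht : t.val < 2
      · -- an XOR slot of a centre edge: centre degree one, and not an end of `e`
        left; left
        have hwx : w ∈ xorPair I j := by
          rw [mem_xorPair_iff]
          fin_cases t
          · exact Or.inl htw.symm
          · exact Or.inr htw.symm
          · exact absurd ht (by decide)
          · exact absurd ht (by decide)
        rw [mem_sdiff]
        constructor
        · rw [hE₁, mem_filter]
          refine ⟨mem_univ _, ?_⟩
          unfold cdeg
          rw [card_eq_one]
          refine ⟨j, eq_singleton_iff_unique_mem.2 ⟨mem_filter.2 ⟨hjC, hwx⟩, fun f' hf' => ?_⟩⟩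
          rw [mem_filter] at hf'
          exact (eq_of_mem_bdry I hjX (hCX hf'.1) hw (xorPair_subset_varSet I j hwx) (xorPair_subset_varSet I f' hf'.2)).symm
        · rw [mem_insert, mem_singleton, not_or]
          have hje : j ≠ e := ne_of_mem_of_mem_sdiff hjC he
          constructor
          · rintro rfl
            exact not_mem_bdry_of_two I (hCX hjC) heX hje (xorPair_subset_varSet I j hwx) (vars_mem_varSet I e 0) hw
          · rintro rfl
            exact not_mem_bdry_of_two I (hCX hjC) heX hje (xorPair_subset_varSet I j hwx) (vars_mem_varSet I e 1) hw
      · push Not at ht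
        have hwa : w ∈ andPair I j := htw ▸ mem_andPair_of_slot I j t ht
        have := andPair_subset_oth hN hjC hwa
        simp only [mem_insert, mem_singleton] at this
        rcases this with rfl | rfl | h
        · exact absurd hw hσb
        · exact absurd hw hτb
        · left; right; exact mem_image.2 ⟨j, hjC, h.symm⟩
  have h1 := (card_le_card hcov).trans ((card_union_le _ _).trans (Nat.add_le_add_right (card_union_le _ _) _))
  have h2 : (C.image (oth I σ τ)).card ≤ 4 := card_image_le.trans hc.le
  have h3 : (andPair I e).card ≤ 2 := PstarChordEndgameTools.card_andPair_le I e
  have h4 : (E₁ \ {a, b}).card + ({a, b} ∩ E₁).card = 2 := by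
    rw [← hη, inter_comm, card_sdiff_add_card_inter]
  rw [hXcard] at hexp
  -- so `{a, b} ∩ E₁ = ∅`: neither end has centre degree one; both have centre degree ≥ 1 and ≤ 2
  have h5 : ({a, b} ∩ E₁).card = 0 := by omega
  rw [card_eq_zero] at h5
  have hnot : ∀ w ∈ ({a, b} : Finset (Fin n)), cdeg I C w ≠ 1 := by
    intro w hw h1'
    have : w ∈ ({a, b} : Finset (Fin n)) ∩ E₁ := mem_inter.2 ⟨hw, by rw [hE₁, mem_filter]; exact ⟨mem_univ _, h1'⟩⟩
    rw [h5] at this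
    exact notMem_empty w this
  have hpos : ∀ {w : Fin n} {f : Fin m}, f ∈ C → w ∈ xorPair I f → 1 ≤ cdeg I C w := by
    intro w f hf hw
    unfold cdeg
    exact card_pos.2 ⟨f, mem_filter.2 ⟨hf, hw⟩⟩
  have hle := cdeg_le_two hI hS hN (J₀ := J₀)
  constructor
  · have := hnot a (mem_insert_self _ _); have := hpos hf₁ ha₁; have := hle a; omega
  · have := hnot b (mem_insert_of_mem (mem_singleton_self _)); have := hpos hf₂ hb₂; have := hle b; omega

include hI hS hN in
/-- Three centre edges whose XOR pairs form a triangle cannot exist: at each vertex the two edges are in different classes. -/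
theorem triangle_edges_false {a b v : Fin n} {f₁ f₂ g : Fin m} (hf₁ : f₁ ∈ C) (hf₂ : f₂ ∈ C) (hg : g ∈ C)
    (hx₁ : xorPair I f₁ = {a, v}) (hx₂ : xorPair I f₂ = {v, b}) (hxg : xorPair I g = {a, b}) (hav : a ≠ v) (hvb : v ≠ b)
    (hab : a ≠ b) : False := by
  classical
  have hne₁₂ : f₁ ≠ f₂ := by
    rintro rfl; rw [hx₁] at hx₂
    have : a ∈ ({v, b} : Finset (Fin n)) := hx₂ ▸ mem_insert_self _ _
    rw [mem_insert, mem_singleton] at this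
    exact this.elim hav hab
  have hne₁ : f₁ ≠ g := by
    rintro rfl; rw [hx₁] at hxg
    have : v ∈ ({a, b} : Finset (Fin n)) := hxg ▸ mem_insert_of_mem (mem_singleton_self _)
    rw [mem_insert, mem_singleton] at this
    exact this.elim hav.symm hvb
  have hne₂ : f₂ ≠ g := by
    rintro rfl; rw [hx₂] at hxg
    have : v ∈ ({a, b} : Finset (Fin n)) := hxg ▸ mem_insert_self _ _
    rw [mem_insert, mem_singleton] at this
    exact this.elim hav.symm hvb
  have hv₁ : v ∈ xorPair I f₁ := by rw [hx₁]; exact mem_insert_of_mem (mem_singleton_self _)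
  have hv₂ : v ∈ xorPair I f₂ := by rw [hx₂]; exact mem_insert_self _ _
  have ha₁ : a ∈ xorPair I f₁ := by rw [hx₁]; exact mem_insert_self _ _
  have hag : a ∈ xorPair I g := by rw [hxg]; exact mem_insert_self _ _
  have hb₂ : b ∈ xorPair I f₂ := by rw [hx₂]; exact mem_insert_of_mem (mem_singleton_self _)
  have hbg : b ∈ xorPair I g := by rw [hxg]; exact mem_insert_of_mem (mem_singleton_self _)
  have h12 := sigma_tau_of_shared hI hS hN hf₁ hf₂ hne₁₂ hv₁ hv₂
  have h1g := sigma_tau_of_shared hI hS hN hf₁ hg hne₁ ha₁ hag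
  have h2g := sigma_tau_of_shared hI hS hN hf₂ hg hne₂ hb₂ hbg
  have nb := fun {f : Fin m} (h1 : f ∈ cls I C σ) (h2 : f ∈ cls I C τ) => not_mem_cls_both hS hN h1 h2
  rcases h12 with ⟨a1, a2⟩ | ⟨a1, a2⟩ <;> rcases h1g with ⟨b1, b2⟩ | ⟨b1, b2⟩ <;> rcases h2g with ⟨c1, c2⟩ | ⟨c1, c2⟩
  · exact nb c1 a2
  · exact nb c2 b2
  · exact nb a1 b1
  · exact nb a1 b1
  · exact nb b1 a1
  · exact nb b1 a1
  · exact nb b2 c2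
  · exact nb a2 c1

include hI hS hN hB hk in
/-- **The case `#cen = 4`, `η = 2`, both classes of size two, two chords is impossible.** -/
theorem four_false (hc : (C).card = 4) (hη : (univ.filter fun v => cdeg I C v = 1).card = 2)
    (hι : (univ.filter fun v => cdeg I C v = 2).card = 3) (hσ2 : (cls I C σ).card = 2) (hτ2 : (cls I C τ).card = 2)
    {e e' : Fin m} (he : e ∈ (J₀ \ C)) (he' : e' ∈ (J₀ \ C)) (hee : e ≠ e') : False := by
  classical
  set T := univ.filter fun v => cdeg I C v = 2 with hT
  -- apex data of both chords
  obtain ⟨v, f₁, hf₁, f₂, hf₂, hne, hx₁, hx₂, hva, hvb, hcv, -⟩ := apex hI hS hN hB hk he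
  obtain ⟨v', f₁', hf₁', f₂', hf₂', hne', hx₁', hx₂', hva', hvb', hcv', -⟩ := apex hI hS hN hB hk he'
  obtain ⟨hca, hcb⟩ := cdeg_end_eq_two hI hS hN hB hk hc hη hσ2 hτ2 he hf₁ hf₂ hx₁ hx₂
  obtain ⟨hca', hcb'⟩ := cdeg_end_eq_two hI hS hN hB hk hc hη hσ2 hτ2 he' hf₁' hf₂' hx₁' hx₂'
  set a := I.vars e 0
  set b := I.vars e 1
  set a' := I.vars e' 0
  set b' := I.vars e' 1
  have hab : a ≠ b := vars_zero_ne_one I hI e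
  have hab' : a' ≠ b' := vars_zero_ne_one I hI e'
  have memT : ∀ {w : Fin n}, cdeg I C w = 2 → w ∈ T := fun h => by rw [hT, mem_filter]; exact ⟨mem_univ _, h⟩
  -- `T = {a, v, b}`
  have hTeq : ({a, v, b} : Finset (Fin n)) = T := by
    apply eq_of_subset_of_card_le
    · intro w hw
      simp only [mem_insert, mem_singleton] at hw
      rcases hw with rfl | rfl | rfl
      · exact memT hca
      · exact memT hcv
      · exact memT hcb
    · rw [hι, card_insert_of_notMem, card_pair hvb]
      rw [mem_insert, mem_singleton, not_or]
      exact ⟨hva.symm, hab⟩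
  have inT : ∀ {w : Fin n}, w ∈ T → w = a ∨ w = v ∨ w = b := fun hw => by
    rw [← hTeq] at hw; simpa [mem_insert, mem_singleton] using hw
  -- the apexes differ
  have hvv : v ≠ v' := by
    intro h
    rw [← h] at hx₁' hx₂' hva' hvb'
    exact hee (apex_inj hI hS hN hf₁ hf₂ hf₁' hf₂' hne hne' hx₁ hx₂ hx₁' hx₂' hva hvb hva' hvb')
  -- a centre edge on `{a, b}`
  have hg : ∃ g ∈ C, xorPair I g = {a, b} := by
    have hv'T := inT (memT hcv')
    have ha'T := inT (memT hca')
    have hb'T := inT (memT hcb')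
    rcases hv'T with h | h | h
    · -- apex of `e'` is `a`: its ends are `{v, b}`
      rcases ha'T with h1 | h1 | h1
      · exact absurd (h1.trans h.symm) hva'.symm
      · -- a' = v, so b' = b
        rcases hb'T with h2 | h2 | h2
        · exact absurd (h2.trans h.symm) hvb'.symm
        · exact absurd (h1.trans h2.symm) hab'
        · exact ⟨f₂', hf₂', by rw [hx₂', h, h2]⟩
      · exact ⟨f₁', hf₁', by rw [hx₁', h, h1, pair_comm]⟩
    · exact absurd h hvv.symm
    · -- apex of `e'` is `b`: its ends are `{a, v}`
      rcases ha'T with h1 | h1 | h1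
      · exact ⟨f₁', hf₁', by rw [hx₁', h, h1]⟩
      · rcases hb'T with h2 | h2 | h2
        · exact ⟨f₂', hf₂', by rw [hx₂', h, h2, pair_comm]⟩
        · exact absurd (h1.trans h2.symm) hab'
        · exact absurd (h2.trans h.symm) hvb'.symm
      · exact absurd (h1.trans h.symm) hva'.symm
  obtain ⟨g, hg, hxg⟩ := hg
  exact triangle_edges_false hI hS hN hf₁ hf₂ hg hx₁ hx₂ hxg hva.symm hvb hab

end Nor

/-- **The NOR-core accounting lemma, generic form.**  An XOR-closed set of outputs carrying NOR data `CoreData I J₀ C σ τ g₀` on a pure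
instance with simple overlaps and `(r, 3/2)`-boundary expansion, of fewer than `r` outputs, has at most `5` outputs. -/
theorem card_le_five {I : LocalMap 4 n m} (hI : I.IsPure xorAndPred) {r : ℕ} (hB : BoundaryExpanding r I) (hS : SimpleOverlap I)
    {J₀ C : Finset (Fin m)} {σ τ : Fin n} {g₀ : Fin m} (hk : J₀.card < r) (hx : XorClosed I J₀) (hN : CoreData I J₀ C σ τ g₀) :
    J₀.card ≤ 5 := by
  classical
  have hsplit := card_cen_add_card_chd C hN.1
  set c := (C).card with hc
  set s := ((J₀ \ C)).card with hs
  by_cases hcls : (cls I C σ).Nonempty ∧ (cls I C τ).Nonempty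
  · -- both classes non-empty: the accounting
    obtain ⟨⟨fσ, hfσ⟩, ⟨fτ, hfτ⟩⟩ := hcls
    have hg := global_count hN hB hk hx 1 1 le_rfl le_rfl
      (fun _ => ⟨fσ, hN.1 (cls_subset I C σ hfσ), andPair_subset_varSet I fσ ((mem_cls I C).1 hfσ).2⟩)
      (fun _ => ⟨fτ, hN.1 (cls_subset I C τ hfτ), andPair_subset_varSet I fτ ((mem_cls I C).1 hfτ).2⟩)
    have hsi := card_chd_le_iota hI hS hN hB hk
    have hhs := two_mul_card_cen hI hS hN
    have hcc := cen_count hN hB hk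
    have hισ := iota_le hI hS hN
    have hιτ := iota_le hI hS (coreData_symm hN)
    have hadd := card_cls_add hS hN
    set η := (univ.filter fun v => cdeg I C v = 1).card with hη
    set ι := (univ.filter fun v => cdeg I C v = 2).card with hι
    have hbσ : 2 ≤ (cls I C σ).card → (if σ ∈ bdry I (C) then 1 else 0) = 0 := fun h2 => by
      rw [if_neg (sigma_not_mem_bdry (cls_subset I C σ) h2)]
    have hbτ : 2 ≤ (cls I C τ).card → (if τ ∈ bdry I (C) then 1 else 0) = 0 := fun h2 => by
      rw [if_neg (sigma_not_mem_bdry (cls_subset I C τ) h2)]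
    have hb1 : (if σ ∈ bdry I (C) then 1 else 0) ≤ 1 := by split_ifs <;> omega
    have hb2 : (if τ ∈ bdry I (C) then 1 else 0) ≤ 1 := by split_ifs <;> omega
    -- everything but the case `c = 4` is linear arithmetic
    by_cases h4 : c = 4 ∧ η = 2
    · exfalso
      obtain ⟨h4c, h4η⟩ := h4
      have hι3 : ι = 3 := by omega
      have hσ2 : (cls I C σ).card = 2 := by
        by_contra h; have := hbτ (by omega); have := hbσ; omega
      have hτ2 : (cls I C τ).card = 2 := by omega
      have hs2 : 2 ≤ s := by omega
      obtain ⟨e, he, e', he', hee⟩ := one_lt_card.1 (by omega : 1 < ((J₀ \ C)).card)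
      exact four_false hI hS hN hB hk h4c h4η hι3 hσ2 hτ2 he he' hee
    · by_cases hσ1 : 2 ≤ (cls I C σ).card <;> by_cases hτ1 : 2 ≤ (cls I C τ).card
      · have := hbσ hσ1; have := hbτ hτ1; omega
      · have := hbσ hσ1; omega
      · have := hbτ hτ1; omega
      · omega
  · -- a class is empty: no chord at all, and the global count gives `#J₀ = #cen ≤ 5`
    have hs0 : s = 0 := by
      rw [hs, card_eq_zero]
      by_contra hne
      obtain ⟨e, he⟩ := nonempty_iff_ne_empty.2 hne
      obtain ⟨v, f₁, hf₁, f₂, hf₂, -, -, -, -, -, -, hcl⟩ := apex hI hS hN hB hk he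
      rcases hcl with ⟨h1, h2⟩ | ⟨h1, h2⟩
      · exact hcls ⟨⟨f₁, h1⟩, ⟨f₂, h2⟩⟩
      · exact hcls ⟨⟨f₂, h2⟩, ⟨f₁, h1⟩⟩
    have hg := global_count hN hB hk hx 0 0 (by omega) (by omega) (fun h => absurd h (by decide)) (fun h => absurd h (by decide))
    omega

end Summit.PneNP.PneNP.Theorems.PstarNorDataProof
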